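import Literature.RepresentationTheory.FiniteGroups.GL2ModularPrincipalSeriesTwistOperator
import Literature.RepresentationTheory.FiniteGroups.GL2ModularPrincipalSeriesLatticeReduction
import HarnessLib

/-!
# Torus lines and the twisting operator in Bruhat coordinates (`coordRep χ₁ χ₂` on `Option F → k`)

Topic `Literature/RepresentationTheory/FiniteGroups`, namespace `Literature.RepresentationTheory.FiniteGroups.GL2`
(sequel of `GL2ModularPrincipalSeriesTorusLines` / `…TwistOperator`, companion of `…LatticeReduction`, whose
coordinate model `coordRep ψ₁ ψ₂ = 𝓑(ψ₁, ψ₂)` transported along the Bruhat basis `bruhatEquiv` is the carrier on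
which the lattice theorem `subrepresentation_coordRep_eq_pow_smul_top` [EmertonGeeSavitt2015, Lemma 4.1.1] is
stated).  DEFINITIONS (`torusVec`, `coordTorusEigenspace`, `coordTwistOp`) + API (reviewed kind); no named fact,
no instance, no notation, no `sorry`.  Everything here is TRANSPORT of the function-model statements along
`bruhatEquiv : 𝓑(χ₁, χ₂) ≃ₗ[k] (Option F → k)` [Bump1997, §4.1 (1.7)]:

* coordinates of the action: `coordRep_apply`, `coordRep_upperUnip_apply_none/some`
  (`u(s)`: `none`-coordinate fixed, `some t ↦ some (t+s)`), `coordRep_diagElt_apply_none/some`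
  (`diag(a,b)`: `none ↦ χ₁(a)χ₂(b)·`, `some t ↦ χ₁(b)χ₂(a)·w(some (tb/a))`);
* `torusVec θ = (none ↦ 0, some t ↦ θ t) = bruhatEquiv (torusFun θ)`, its torus eigen-relation
  `coordRep_diagElt_torusVec`; `coordTorusEigenspace ε` and `coordTorusEigenspace_eq_map` (= image of
  `torusEigenspace ε`), **`coordTorusEigenspace_eq_span_torusVec`**, `coordTorusInvariants_eq_span`,
  `coordTorusEigenspace_quadratic_eq_span` (over a domain);
* `coordTwistOp χ = Σ_a χ(a)·coordRep(u(a))`, `coordTwistOp_bruhatEval` (it is `twistOp` in coordinates),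
  **`coordTwistOp_torusVec`** `T_χ e_θ = χ(−1)J(θ,χ)·e_{θχ}` [IrelandRosen1990, Ch. 8 §3], `diagElt_mul_coordTwistOp`,
  and the two index statements `map_coordTwistOp_coordTorusInvariants`, `map_coordTwistOp_coordTorusEigenspace_quadratic`.
-/

noncomputable section

namespace Literature.RepresentationTheory.FiniteGroups

namespace GL2

open Matrix Finset

section CoordAction

variable {F : Type} [Field F] [DecidableEq F] {k : Type*} [CommRing k] (χ₁ χ₂ : Fˣ →* kˣ)

/-- Unfolding: `coordRep g w = bruhatEval (g · bruhatLift w)`. [cite: Bump1997, §4.1 Eq. (1.7)] -/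
theorem coordRep_apply (g : GL (Fin 2) F) (w : Option F → k) :
    coordRep χ₁ χ₂ g w = bruhatEval χ₁ χ₂ (principalSeriesRep F χ₁ χ₂ g (bruhatLift χ₁ χ₂ w)) := rfl

/-- `coordRep g (bruhatEval f) = bruhatEval (g·f)` (the Bruhat basis map intertwines). [cite: Bump1997, §4.1 Eq. (1.7)] -/
theorem coordRep_bruhatEval (g : GL (Fin 2) F)
    (f : Representation.coindV (borel F).subtype (scalarRep (borelCharacter F χ₁ χ₂))) :
    coordRep χ₁ χ₂ g (bruhatEval χ₁ χ₂ f) = bruhatEval χ₁ χ₂ (principalSeriesRep F χ₁ χ₂ g f) := by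
  rw [coordRep_apply, bruhatLift_bruhatEval]

/-- `u(s)` fixes the `none`-coordinate. [cite: Bump1997, §4.1 Eq. (1.7)] -/
theorem coordRep_upperUnip_apply_none (s : F) (w : Option F → k) :
    coordRep χ₁ χ₂ (upperUnip F s) w none = w none := by
  rw [coordRep_apply, bruhatEval_none, upperUnip_smul_apply_one, ← bruhatEval_none χ₁ χ₂, bruhatEval_bruhatLift]

/-- `u(s)` translates the `some`-coordinates: `(u(s)·w)(some t) = w(some (t + s))`. [cite: Bump1997, §4.1 Eq. (1.7)] -/
theorem coordRep_upperUnip_apply_some (s t : F) (w : Option F → k) :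
    coordRep χ₁ χ₂ (upperUnip F s) w (some t) = w (some (t + s)) := by
  rw [coordRep_apply, bruhatEval_some, upperUnip_smul_apply_weyl_upperUnip, ← bruhatEval_some χ₁ χ₂,
    bruhatEval_bruhatLift]

/-- `(diag(a,b)·w)(none) = χ₁(a)χ₂(b)·w(none)`. [cite: Bump1997, §4.1 Eq. (1.6)] -/
theorem coordRep_diagElt_apply_none (a b : Fˣ) (w : Option F → k) :
    coordRep χ₁ χ₂ (diagElt F a b) w none = (χ₁ a : k) * (χ₂ b : k) * w none := by
  rw [coordRep_apply, bruhatEval_none, diagElt_smul_apply_one, ← bruhatEval_none χ₁ χ₂, bruhatEval_bruhatLift]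

/-- `(diag(a,b)·w)(some t) = χ₁(b)χ₂(a)·w(some (t b/a))`. [cite: Bump1997, §4.1 Thm. 4.1.1 (proof)] -/
theorem coordRep_diagElt_apply_some (a b : Fˣ) (t : F) (w : Option F → k) :
    coordRep χ₁ χ₂ (diagElt F a b) w (some t) = (χ₁ b : k) * (χ₂ a : k) * w (some (t * b / a)) := by
  rw [coordRep_apply, bruhatEval_some, diagElt_smul_apply_weyl_upperUnip, ← bruhatEval_some χ₁ χ₂,
    bruhatEval_bruhatLift]

/-- **The torus line vector** `e_θ = (none ↦ 0, some t ↦ θ(t))`, the Bruhat coordinates of `φ_θ`. [cite: Bump1997, §4.1 Thm. 4.1.1 (proof)] -/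
def torusVec (θ : MulChar F k) : Option F → k := fun o => Option.elim o 0 fun t => θ t

omit [DecidableEq F] in
/-- `e_θ(none) = 0`. [cite: Bump1997, §4.1 Thm. 4.1.1 (proof)] -/
@[simp] theorem torusVec_none (θ : MulChar F k) : torusVec θ none = 0 := rfl

omit [DecidableEq F] in
/-- `e_θ(some t) = θ t`. [cite: Bump1997, §4.1 Thm. 4.1.1 (proof)] -/
@[simp] theorem torusVec_some (θ : MulChar F k) (t : F) : torusVec θ (some t) = θ t := rfl

/-- `e_θ = bruhatEval φ_θ`. [cite: Bump1997, §4.1 Thm. 4.1.1 (proof)] -/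
theorem bruhatEval_torusFun_eq_torusVec (θ : MulChar F k) :
    bruhatEval χ₁ χ₂ (torusFun χ₁ χ₂ θ) = torusVec θ :=
  bruhatEval_torusFun χ₁ χ₂ θ

/-- `bruhatLift e_θ = φ_θ`. [cite: Bump1997, §4.1 Thm. 4.1.1 (proof)] -/
theorem bruhatLift_torusVec (θ : MulChar F k) : bruhatLift χ₁ χ₂ (torusVec θ) = torusFun χ₁ χ₂ θ := rfl

omit [DecidableEq F] in
/-- `e_θ ≠ 0`. [cite: Bump1997, §4.1 Thm. 4.1.1 (proof)] -/
theorem torusVec_ne_zero [Nontrivial k] (θ : MulChar F k) : torusVec θ ≠ 0 := by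
  intro h
  have := congrFun h (some 1)
  rw [torusVec_some, map_one, Pi.zero_apply] at this
  exact one_ne_zero this

/-- **`e_θ` is a torus eigenvector** in the coordinate model: `diag(a,b)·e_θ = χ₁(b)χ₂(a)θ(b)θ⁻¹(a)·e_θ`.
[cite: Bump1997, §4.1 Thm. 4.1.1 (proof)] -/
theorem coordRep_diagElt_torusVec (θ : MulChar F k) (a b : Fˣ) :
    coordRep χ₁ χ₂ (diagElt F a b) (torusVec θ) = ((χ₁ b : k) * (χ₂ a : k) * (θ b * θ⁻¹ a)) • torusVec θ := by
  rw [← bruhatEval_torusFun_eq_torusVec, coordRep_bruhatEval, principalSeriesRep_diagElt_torusFun, map_smul]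

/-- The torus eigenspace of the coordinate model for the eigenvalue function `ε`. [cite: Bump1997, §4.1 Thm. 4.1.1 (proof)] -/
def coordTorusEigenspace (ε : Fˣ → Fˣ → k) : Submodule k (Option F → k) where
  carrier := {w | ∀ a b : Fˣ, coordRep χ₁ χ₂ (diagElt F a b) w = ε a b • w}
  add_mem' hf hg a b := by rw [map_add, hf, hg, smul_add]
  zero_mem' a b := by rw [map_zero, smul_zero]
  smul_mem' c f hf a b := by
    show coordRep χ₁ χ₂ (diagElt F a b) (c • f) = ε a b • (c • f)
    rw [map_smul, hf, smul_comm]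

/-- Membership. [cite: Bump1997, §4.1 Thm. 4.1.1 (proof)] -/
theorem mem_coordTorusEigenspace_iff (ε : Fˣ → Fˣ → k) (w : Option F → k) :
    w ∈ coordTorusEigenspace χ₁ χ₂ ε ↔ ∀ a b : Fˣ, coordRep χ₁ χ₂ (diagElt F a b) w = ε a b • w :=
  Iff.rfl

/-- The coordinate eigenspace is the image of the function-model eigenspace under the Bruhat basis map.
[cite: Bump1997, §4.1 Thm. 4.1.1 (proof)] -/
theorem coordTorusEigenspace_eq_map (ε : Fˣ → Fˣ → k) :
    coordTorusEigenspace χ₁ χ₂ ε =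
      (torusEigenspace χ₁ χ₂ ε).map (bruhatEquiv χ₁ χ₂ : _ →ₗ[k] (Option F → k)) := by
  ext w
  rw [Submodule.mem_map_equiv, mem_torusEigenspace_iff, mem_coordTorusEigenspace_iff]
  refine forall_congr' fun a => forall_congr' fun b => ?_
  rw [bruhatEquiv_symm_apply, coordRep_apply]
  constructor
  · intro h
    apply (bruhatEquiv χ₁ χ₂).injective
    rw [map_smul, bruhatEquiv_apply, bruhatEquiv_apply, bruhatEval_bruhatLift, h]
  · intro h
    rw [h, map_smul, bruhatEval_bruhatLift]

/-- `e_θ` lies in its eigenspace. [cite: Bump1997, §4.1 Thm. 4.1.1 (proof)] -/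
theorem torusVec_mem_coordTorusEigenspace (θ : MulChar F k) :
    torusVec θ ∈ coordTorusEigenspace χ₁ χ₂ fun a b => (χ₁ b : k) * (χ₂ a : k) * (θ b * θ⁻¹ a) :=
  fun a b => coordRep_diagElt_torusVec χ₁ χ₂ θ a b

variable [IsDomain k]

/-- **Torus eigenspaces of the coordinate model are lines**: for `θ ≠ 1`, `χ₁θ ≠ χ₂`, over a domain,
`{w : diag(a,b)·w = χ₁(b)χ₂(a)θ(b)θ⁻¹(a)·w} = k·e_θ`. [cite: Bump1997, §4.1 Thm. 4.1.1 (proof)] -/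
theorem coordTorusEigenspace_eq_span_torusVec (θ : MulChar F k) (hθ : θ ≠ 1)
    (hθ' : MulChar.ofUnitHom χ₁ * θ ≠ MulChar.ofUnitHom χ₂) :
    coordTorusEigenspace χ₁ χ₂ (fun a b => (χ₁ b : k) * (χ₂ a : k) * (θ b * θ⁻¹ a)) = k ∙ torusVec θ := by
  rw [coordTorusEigenspace_eq_map, torusEigenspace_eq_span_torusFun χ₁ χ₂ θ hθ hθ', Submodule.map_span,
    Set.image_singleton, LinearEquiv.coe_coe, bruhatEquiv_apply, bruhatEval_torusFun_eq_torusVec]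

/-- **`T`-invariants of the coordinate model** (`χ₁χ₂ = 1`, `χ₁ ≠ 1`): `k·e_{χ₂}`. [cite: Bump1997, §4.1 Thm. 4.1.1 (proof)] -/
theorem coordTorusInvariants_eq_span (h12 : χ₁ * χ₂ = 1) (h1 : χ₁ ≠ 1) :
    coordTorusEigenspace χ₁ χ₂ (fun _ _ => (1 : k)) = k ∙ torusVec (MulChar.ofUnitHom χ₂) := by
  rw [coordTorusEigenspace_eq_map, torusInvariants_eq_span χ₁ χ₂ h12 h1, Submodule.map_span,
    Set.image_singleton, LinearEquiv.coe_coe, bruhatEquiv_apply, bruhatEval_torusFun_eq_torusVec]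

/-- **The `χ∘det`-eigenspace of the coordinate model** (`χ₁χ₂ = 1`, `χ` quadratic, `χ ∉ {χ₁, χ₂}`): `k·e_{χ₂χ}`.
[cite: Bump1997, §4.1 Thm. 4.1.1 (proof)] -/
theorem coordTorusEigenspace_quadratic_eq_span (h12 : χ₁ * χ₂ = 1) {χ : MulChar F k} (hχ : χ⁻¹ = χ)
    (hχ1 : χ ≠ MulChar.ofUnitHom χ₁) (hχ2 : χ ≠ MulChar.ofUnitHom χ₂) :
    coordTorusEigenspace χ₁ χ₂ (fun a b : Fˣ => χ (a : F) * χ (b : F)) =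
      k ∙ torusVec (MulChar.ofUnitHom χ₂ * χ) := by
  rw [coordTorusEigenspace_eq_map, torusEigenspace_quadratic_eq_span χ₁ χ₂ h12 hχ hχ1 hχ2, Submodule.map_span,
    Set.image_singleton, LinearEquiv.coe_coe, bruhatEquiv_apply, bruhatEval_torusFun_eq_torusVec]

end CoordAction

section CoordTwist

variable {F : Type} [Field F] [Fintype F] [DecidableEq F] {k : Type*} [CommRing k] (χ₁ χ₂ : Fˣ →* kˣ)

/-- **The twisting operator in coordinates**: `T_χ = Σ_a χ(a)·coordRep(u(a))`. [cite: Bump1997, §4.1 Eq. (1.7)] -/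
def coordTwistOp (χ : MulChar F k) : (Option F → k) →ₗ[k] (Option F → k) :=
  ∑ a : F, χ a • coordRep χ₁ χ₂ (upperUnip F a)

/-- Unfolding. [cite: Bump1997, §4.1 Eq. (1.7)] -/
theorem coordTwistOp_apply (χ : MulChar F k) (w : Option F → k) :
    coordTwistOp χ₁ χ₂ χ w = ∑ a : F, χ a • coordRep χ₁ χ₂ (upperUnip F a) w := by
  rw [coordTwistOp, LinearMap.sum_apply]
  rfl

/-- `coordTwistOp` is `twistOp` read in Bruhat coordinates. [cite: Bump1997, §4.1 Eq. (1.7)] -/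
theorem coordTwistOp_bruhatEval (χ : MulChar F k)
    (f : Representation.coindV (borel F).subtype (scalarRep (borelCharacter F χ₁ χ₂))) :
    coordTwistOp χ₁ χ₂ χ (bruhatEval χ₁ χ₂ f) = bruhatEval χ₁ χ₂ (twistOp χ₁ χ₂ χ f) := by
  rw [coordTwistOp_apply, twistOp_apply, map_sum]
  refine sum_congr rfl fun a _ => ?_
  rw [map_smul, coordRep_bruhatEval]

/-- The `none`-coordinate of `T_χ w` is `(Σ_a χ(a))·w(none)`. [cite: Bump1997, §4.1 Eq. (1.7)] -/
theorem coordTwistOp_apply_none (χ : MulChar F k) (w : Option F → k) :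
    coordTwistOp χ₁ χ₂ χ w none = (∑ a : F, χ a) * w none := by
  rw [coordTwistOp_apply, Finset.sum_apply, sum_mul]
  refine sum_congr rfl fun a _ => ?_
  rw [Pi.smul_apply, smul_eq_mul, coordRep_upperUnip_apply_none]

/-- The `some t`-coordinate of `T_χ w` is `Σ_a χ(a)·w(some (t + a))`. [cite: Bump1997, §4.1 Eq. (1.7)] -/
theorem coordTwistOp_apply_some (χ : MulChar F k) (w : Option F → k) (t : F) :
    coordTwistOp χ₁ χ₂ χ w (some t) = ∑ a : F, χ a * w (some (t + a)) := by
  rw [coordTwistOp_apply, Finset.sum_apply]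
  refine sum_congr rfl fun a _ => ?_
  rw [Pi.smul_apply, smul_eq_mul, coordRep_upperUnip_apply_some]

/-- Torus semi-invariance in coordinates: `coordRep(diag(a,b)) ∘ T_χ = χ(b/a)·T_χ ∘ coordRep(diag(a,b))`.
[cite: Bump1997, §4.1 Eq. (1.7)] -/
theorem diagElt_mul_coordTwistOp (χ : MulChar F k) (a b : Fˣ) :
    coordRep χ₁ χ₂ (diagElt F a b) * coordTwistOp χ₁ χ₂ χ =
      χ ((b : F) / a) • (coordTwistOp χ₁ χ₂ χ * coordRep χ₁ χ₂ (diagElt F a b)) := by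
  refine LinearMap.ext fun w => ?_
  rw [Module.End.mul_apply, LinearMap.smul_apply, Module.End.mul_apply]
  obtain ⟨f, rfl⟩ : ∃ f, bruhatEval χ₁ χ₂ f = w := ⟨bruhatLift χ₁ χ₂ w, bruhatEval_bruhatLift χ₁ χ₂ w⟩
  rw [coordTwistOp_bruhatEval, coordRep_bruhatEval, coordRep_bruhatEval, coordTwistOp_bruhatEval, ← map_smul]
  congr 1
  have h := congrArg (fun T => T f) (diagElt_mul_twistOp χ₁ χ₂ χ a b)
  simpa only [Module.End.mul_apply, LinearMap.smul_apply] using h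

/-- `T_χ` maps coordinate torus eigenvectors to torus eigenvectors (eigenvalue twisted by `χ(b/a)`).
[cite: Bump1997, §4.1 Eq. (1.7)] -/
theorem coordTwistOp_mem_coordTorusEigenspace (χ : MulChar F k) {ε : Fˣ → Fˣ → k} {w : Option F → k}
    (hw : w ∈ coordTorusEigenspace χ₁ χ₂ ε) :
    coordTwistOp χ₁ χ₂ χ w ∈ coordTorusEigenspace χ₁ χ₂ fun a b => χ ((b : F) / a) * ε a b := by
  intro a b
  have h := congrArg (fun T => T w) (diagElt_mul_coordTwistOp χ₁ χ₂ χ a b)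
  simp only [Module.End.mul_apply, LinearMap.smul_apply] at h
  rw [h, hw a b, map_smul, smul_smul]

variable [IsDomain k]

/-- **`T_χ e_θ = χ(−1)·J(θ,χ)·e_{θχ}`** in coordinates (`θχ ≠ 1`, `k` a domain). [cite: IrelandRosen1990, Ch. 8 §3 Thm. 1] -/
theorem coordTwistOp_torusVec (χ θ : MulChar F k) (hθχ : θ * χ ≠ 1) :
    coordTwistOp χ₁ χ₂ χ (torusVec θ) = (χ (-1) * jacobiSum θ χ) • torusVec (θ * χ) := by
  rw [← bruhatEval_torusFun_eq_torusVec χ₁ χ₂, coordTwistOp_bruhatEval, twistOp_torusFun χ₁ χ₂ χ θ hθχ, map_smul,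
    bruhatEval_torusFun_eq_torusVec]

/-- Line form in coordinates. [cite: IrelandRosen1990, Ch. 8 §3 Thm. 1] -/
theorem map_coordTwistOp_span_torusVec (χ θ : MulChar F k) (hθχ : θ * χ ≠ 1) :
    (k ∙ torusVec θ).map (coordTwistOp χ₁ χ₂ χ) = k ∙ ((χ (-1) * jacobiSum θ χ) • torusVec (θ * χ)) := by
  rw [Submodule.map_span, Set.image_singleton, coordTwistOp_torusVec χ₁ χ₂ χ θ hθχ]

/-- **`T_χ` on the `T`-invariant line of the coordinate model** (`χ₁χ₂ = 1`, `χ₁ ≠ 1`, `χ ≠ χ₁`):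
`T_χ({w : T·w = w}) = k·(χ(−1)J(χ₂,χ)·e_{χ₂χ})`. [cite: IrelandRosen1990, Ch. 8 §3 Thm. 1] -/
theorem map_coordTwistOp_coordTorusInvariants (h12 : χ₁ * χ₂ = 1) (h1 : χ₁ ≠ 1) {χ : MulChar F k}
    (hχ1 : χ ≠ MulChar.ofUnitHom χ₁) :
    (coordTorusEigenspace χ₁ χ₂ fun _ _ => (1 : k)).map (coordTwistOp χ₁ χ₂ χ) =
      k ∙ ((χ (-1) * jacobiSum (MulChar.ofUnitHom χ₂) χ) • torusVec (MulChar.ofUnitHom χ₂ * χ)) := by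
  rw [coordTorusInvariants_eq_span χ₁ χ₂ h12 h1,
    map_coordTwistOp_span_torusVec χ₁ χ₂ χ _ (ofUnitHom_mul_ne_one χ₁ χ₂ h12 hχ1)]

/-- **`T_χ` on the `χ∘det`-eigen-line of the coordinate model** (`χ₁χ₂ = 1`, `χ₁ ≠ 1`, `χ` quadratic,
`χ ∉ {χ₁, χ₂}`): `T_χ({w : diag(a,b)·w = χ(ab)·w}) = k·(χ(−1)J(χ₂χ,χ)·e_{χ₂})` — inside the `T`-invariant line
`k·e_{χ₂}` with «index» the ideal `(J(χ₂χ, χ))`. [cite: IrelandRosen1990, Ch. 8 §3 Thm. 1] -/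
theorem map_coordTwistOp_coordTorusEigenspace_quadratic (h12 : χ₁ * χ₂ = 1) (h1 : χ₁ ≠ 1) {χ : MulChar F k}
    (hχ : χ⁻¹ = χ) (hχ1 : χ ≠ MulChar.ofUnitHom χ₁) (hχ2 : χ ≠ MulChar.ofUnitHom χ₂) :
    (coordTorusEigenspace χ₁ χ₂ fun a b : Fˣ => χ (a : F) * χ (b : F)).map (coordTwistOp χ₁ χ₂ χ) =
      k ∙ ((χ (-1) * jacobiSum (MulChar.ofUnitHom χ₂ * χ) χ) • torusVec (MulChar.ofUnitHom χ₂)) := by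
  have hχχ : χ * χ = 1 := by
    nth_rw 1 [← hχ]
    exact inv_mul_cancel χ
  have hne : MulChar.ofUnitHom χ₂ * χ * χ ≠ 1 := by
    rw [mul_assoc, hχχ, mul_one]
    exact ofUnitHom_ne_one χ₁ χ₂ h12 h1
  rw [coordTorusEigenspace_quadratic_eq_span χ₁ χ₂ h12 hχ hχ1 hχ2, map_coordTwistOp_span_torusVec χ₁ χ₂ χ _ hne,
    mul_assoc, hχχ, mul_one]

end CoordTwist

end GL2

end Literature.RepresentationTheory.FiniteGroups
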